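import Summits.BirchSwinnertonDyer.BirchSwinnertonDyer.Theorems.PrintCf2SplitBadTwoRestrictedSelmerPairSkeleton
import Literature.NumberTheory.EllipticCurves.IwasawaSelmerProofs
import HarnessLib

/-!
# Crux `PrintCf2.SplitBadTwoRankOneOfFacts` (stmt-BirchSwinnertonDyer-20368), road α v10.3 — S3c residual (F3), piece (P1), base half:
# `#𝔖_{v̄}(K, M) = #(𝔖_v(K, M) ⊓ 𝔖_{v̄}(K, M)) · #loc_v(𝔖_{v̄}(K, M))` — the image at the relaxed place is the index of the doubly-strict group

Cell `bsd-print-cf2`, width seat `bsd-line-cf2-p1-w5` g3 (prover-bsd-line-cf2-p1-w5-g3-0); memo `Cruxes/SplitBadTwoRankOneOfFacts/F3-PLAN-w5g3.md` (P1).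
`--supports stmt-BirchSwinnertonDyer-20368` (helper, Theses-free). HONEST FRAMING: nothing here closes the crux or a registered stub; BSD is not proved
by any of this; no summit statement is proved by this seat. No definition, no named fact, no `sorry`.

WHAT (generic: number field `K`, discrete `Γ_K`-module `M`, `p`, places `v`, `v̄`). The (F3) hypothesis of LEAD g12's cut 12
(`restrictedControl_two_of_locSurj_factor_values`, p674084; -w8 g2 `CMPrimes.rBV_of_factor_values_of_sel`) measures
`#range(loc_v ∘ subtype : 𝔖_{v̄}(K, W*) → H¹(⊤ ⊓ D_v, W*))`. -w7's pair skeleton (`card_restrictedSelmer_eq_card_inf_mul_card_localTerm`) has the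
analogous identity for a general `H ⊴ Γ_K` with the ALL-CONJUGATES local term `Λ_v = (res_{H ⊓ D_v} ∘ conj_σ)_σ`. Over the BASE (`H = ⊤`) the
conjugations act trivially on `H¹(⊤, M)` (`conjH1_of_mem`), so the kernel of the plain `loc_v` on `𝔖_{v̄}(K, M)` is already the doubly-strict group:
* `ker_resOfLe_comp_subtype_restrictedSelmerBase` — `ker(loc_v|_{𝔖_{v̄}(K,M)}) = (𝔖_v(K,M) ⊓ 𝔖_{v̄}(K,M))` inside `𝔖_{v̄}(K,M)`;
* **`card_restrictedSelmerBase_eq_card_inf_mul_card_range_resOfLe`** — `#𝔖_{v̄}(K,M) = #(𝔖_v ⊓ 𝔖_{v̄})(K,M) · #range(loc_v ∘ subtype)` (`Nat.card`);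
  so (F3) ⟺ «`v₂ [𝔖_{v̄}(K,W*) : 𝔖_v(K,W*) ⊓ 𝔖_{v̄}(K,W*)] = ℓ + e₃([d]₂)`», the form in which the finite-level Poitou–Tate count (P2) delivers it
  (`[H¹_{𝓕_N} : H¹_{𝓕′_N}]`, memo §1–§2).
presearch: not applicable (first isomorphism theorem). beyond-print theorem: no.

References: [Agboola2007] §3 (arXiv p0008:L50–68), §6 Prop. 6.10–6.11; [NeukirchSchmidtWingberg2008] I §5.
-/

noncomputable section

open scoped Classical

set_option linter.dupNamespace false
set_option autoImplicit false

open NumberField IsDedekindDomain Field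
open Literature.NumberTheory.EllipticCurves Literature.NumberTheory.EllipticCurves.GreenbergSelmer
open Literature.NumberTheory.EllipticCurves.Agboola2007
open Literature.NumberTheory.GaloisRepresentations

universe u

namespace Summit.BirchSwinnertonDyer.BirchSwinnertonDyer.Theorems.PrintCf2.RestrictedSelmerPair

section Base

variable {K : Type u} [Field K] [NumberField K] (M : Type u) [AddCommGroup M]
  [DistribMulAction (absoluteGaloisGroup K) M] [TopologicalSpace M] [DiscreteTopology M]
  (p : ℕ) (v vbar : HeightOneSpectrum (𝓞 K))

/-- **Over the base, `ker(loc_v|_{𝔖_{v̄}(K, M)})` is the doubly-strict group `𝔖_v(K, M) ⊓ 𝔖_{v̄}(K, M)`**: the two restricted groups share the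
conditions away from `p` and at infinity, and the strict condition of `𝔖_v` at `v` («all conjugates die on `⊤ ⊓ D_v`») is, on `H¹(⊤, M)` where
`conj_σ = id`, just `loc_v c = 0`. [cite: Agboola2007, §3 (arXiv p0008:L58–68)] [cite: NeukirchSchmidtWingberg2008, I §5 (1.6.3)] -/
theorem ker_resOfLe_comp_subtype_restrictedSelmerBase :
    ((resOfLe M (inf_le_left : (⊤ : Subgroup (absoluteGaloisGroup K)) ⊓ decomp v ≤ ⊤)).comp
        (restrictedSelmerBase M p vbar).subtype).ker =
      (restrictedSelmerBase M p v ⊓ restrictedSelmerBase M p vbar).addSubgroupOf (restrictedSelmerBase M p vbar) := by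
  have hconj : ∀ (σ : absoluteGaloisGroup K) (c : subgroupH1 (⊤ : Subgroup (absoluteGaloisGroup K)) M),
      conjH1 (⊤ : Subgroup (absoluteGaloisGroup K)) M σ c = c := fun σ c ↦ by
    rw [conjH1_of_mem_holds (⊤ : Subgroup (absoluteGaloisGroup K)) M (Subgroup.mem_top σ), AddMonoidHom.id_apply]
  ext c
  rw [AddMonoidHom.mem_ker, AddMonoidHom.comp_apply, AddSubgroup.coe_subtype, AddSubgroup.mem_addSubgroupOf, AddSubgroup.mem_inf]
  constructor
  · intro h0
    refine ⟨?_, c.2⟩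
    have hc := (mem_restrictedSelmer_iff_resOfLe ⊤ M p vbar (c : subgroupH1 ⊤ M)).mp c.2
    rw [restrictedSelmerBase, mem_restrictedSelmer_iff_resOfLe]
    refine ⟨hc.1, hc.2.1, fun σ ↦ ?_⟩
    rw [hconj]
    exact h0
  · rintro ⟨hv, -⟩
    have h := ((mem_restrictedSelmer_iff_resOfLe ⊤ M p v (c : subgroupH1 ⊤ M)).mp hv).2.2 1
    rwa [hconj] at h

/-- **`#𝔖_{v̄}(K, M) = #(𝔖_v(K, M) ⊓ 𝔖_{v̄}(K, M)) · #range(loc_v ∘ subtype)`** (`Nat.card`; Lagrange + first isomorphism theorem for `loc_v` on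
`𝔖_{v̄}(K, M)`): the order of the image of Agboola's reversed group at the relaxed place `v` — the quantity of (F3) — is the index of the doubly-strict
group. [cite: Agboola2007, §3 (arXiv p0008:L50–68), §6 Prop. 6.10–6.11] -/
theorem card_restrictedSelmerBase_eq_card_inf_mul_card_range_resOfLe :
    Nat.card (restrictedSelmerBase M p vbar) =
      Nat.card ↥(restrictedSelmerBase M p v ⊓ restrictedSelmerBase M p vbar) *
        Nat.card ((resOfLe M (inf_le_left : (⊤ : Subgroup (absoluteGaloisGroup K)) ⊓ decomp v ≤ ⊤)).comp
          (restrictedSelmerBase M p vbar).subtype).range := by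
  set f := (resOfLe M (inf_le_left : (⊤ : Subgroup (absoluteGaloisGroup K)) ⊓ decomp v ≤ ⊤)).comp
    (restrictedSelmerBase M p vbar).subtype with hf
  rw [AddSubgroup.card_eq_card_quotient_mul_card_addSubgroup f.ker,
    Nat.card_congr (QuotientAddGroup.quotientKerEquivRange f).toEquiv, hf, ker_resOfLe_comp_subtype_restrictedSelmerBase,
    Nat.card_congr (AddSubgroup.addSubgroupOfEquivOfLe
      (inf_le_right : restrictedSelmerBase M p v ⊓ restrictedSelmerBase M p vbar ≤ _)).toEquiv,
    mul_comm]

/-- The valuation form used by (F3): if the doubly-strict group and the image are finite and non-empty (they are subgroups), then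
`v_q #𝔖_{v̄}(K, M) = v_q #(𝔖_v ⊓ 𝔖_{v̄})(K, M) + v_q #range(loc_v ∘ subtype)` for every prime `q`. [cite: Agboola2007, §6 Prop. 6.10–6.11] -/
theorem padicValNat_card_restrictedSelmerBase_eq (q : ℕ) [Fact q.Prime]
    [Finite (restrictedSelmerBase M p vbar)] :
    padicValNat q (Nat.card (restrictedSelmerBase M p vbar)) =
      padicValNat q (Nat.card ↥(restrictedSelmerBase M p v ⊓ restrictedSelmerBase M p vbar)) +
        padicValNat q (Nat.card ((resOfLe M (inf_le_left : (⊤ : Subgroup (absoluteGaloisGroup K)) ⊓ decomp v ≤ ⊤)).comp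
          (restrictedSelmerBase M p vbar).subtype).range) := by
  haveI : Finite ↥(restrictedSelmerBase M p v ⊓ restrictedSelmerBase M p vbar) :=
    Finite.of_injective _ (AddSubgroup.inclusion_injective (inf_le_right : restrictedSelmerBase M p v ⊓ restrictedSelmerBase M p vbar ≤ _))
  haveI : Finite ((resOfLe M (inf_le_left : (⊤ : Subgroup (absoluteGaloisGroup K)) ⊓ decomp v ≤ ⊤)).comp
      (restrictedSelmerBase M p vbar).subtype).range :=
    Finite.of_surjective _ (AddMonoidHom.rangeRestrict_surjective _)
  rw [card_restrictedSelmerBase_eq_card_inf_mul_card_range_resOfLe M p v vbar,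
    padicValNat.mul (Nat.card_pos (α := ↥(restrictedSelmerBase M p v ⊓ restrictedSelmerBase M p vbar))).ne'
      (Nat.card_pos (α := ((resOfLe M (inf_le_left : (⊤ : Subgroup (absoluteGaloisGroup K)) ⊓ decomp v ≤ ⊤)).comp
        (restrictedSelmerBase M p vbar).subtype).range)).ne']

end Base

end Summit.BirchSwinnertonDyer.BirchSwinnertonDyer.Theorems.PrintCf2.RestrictedSelmerPair

end
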